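import Summits.BirchSwinnertonDyer.BirchSwinnertonDyer.Theorems.GenusKolyvaginAtTwoTorsionCellSELRelaxedInfty
import HarnessLib

/-!
# SEL (iso-class Selmer pair law), C1-P′: the form bits of a class supported on `S ∪ {q}`

Crux R″ `RankOneTwoTorsionResidualAtTwo` (stmt-27478), LINE 49 «full_vertex», SUPPORT stub SEL
`IsoClassSelmerPairLawAtTwo`, the `C₁` conjunct (LEAD memo `Cruxes/…/Lines/torsion_cell_full_vertex_SEL_C1_road_g36.md`,
§2 (R4): the reciprocity constraints that pin the extra relaxed class `z`).  For a curve `E/ℚ` with rational `2`-torsion,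
root differences units off `S ∋ 2`, ONE prime `q ∉ S`, `q ≡ 3 (mod 4)`, and a class `c ∈ H¹(ℚ, E[2])` with components
`a, b` of even valuation at every prime outside `S ∪ {q}` satisfying `E`'s local condition at the primes of `S`:
**`sum_descentFormBits_one_eq_zero`** — the bit of the Hilbert-symbol Tate form at `∞` plus the bit at `q` vanishes
(the `out = {q}` case between `…SELRelaxedInfty` (`out = ∅`) and g35's `…D0ParityLocal` (`out = {p, q₁, q₂}`)).
Applied to `z`, `z + κ(T₁)`, `z + κ(T₂)` it yields the three constraints of the memo.

Everything is proved; no LINE 49 statement is restated; BSD is not advanced by this file alone.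

## References

* [KlagsbrunMazurRubin2013] Z. Klagsbrun, B. Mazur, K. Rubin, Ann. of Math. 178 (2013), Def. 3.3, Thm. 3.9.
* [Serre1973] J.-P. Serre, *A Course in Arithmetic*, Ch. III §1.2 Thm. 1, §2.1 Thm. 3.
* [SilvermanAEC2009] J. H. Silverman, *The Arithmetic of Elliptic Curves*, 2nd ed., Prop. X.1.4, Prop. X.4.9.
-/

noncomputable section

open scoped Classical

namespace Summit.BirchSwinnertonDyer.BirchSwinnertonDyer.Theorems.GenusKolyvaginAtTwo.TorsionCellSEL

open WeierstrassCurve WeierstrassCurve.Affine WeierstrassCurve.Affine.Point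
open Literature.NumberTheory.GaloisRepresentations Literature.NumberTheory.EllipticCurves Field
open Literature.NumberTheory.EllipticCurves.TwoDescentLocal
open Literature.NumberTheory.EllipticCurves.KramerTwoDescent
open Literature.NumberTheory.QuadraticForms
open Summit.BirchSwinnertonDyer.BirchSwinnertonDyer.Theorems.GenusKolyvaginAtTwo.TorsionCellD0
open IsDedekindDomain NumberField Rat.HeightOneSpectrum

variable (E : WeierstrassCurve ℚ) [E.IsElliptic] {e₁ e₂ e₃ : ℚ} (S : Finset ℕ) {q : ℕ} [hq : Fact q.Prime]

/-- **The form bits at `∞` and at one prime `q`** of a class supported on `S ∪ {q}` with `E`'s local conditions at `S`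
sum to zero. [cite: KlagsbrunMazurRubin2013, Def. 3.3, Thm. 3.9] [cite: Serre1973, Ch. III §2.1 Thm. 3] -/
theorem sum_descentFormBits_one_eq_zero (h : E.toAffine.SplitTwoTorsion e₁ e₂ e₃) (h2S : 2 ∈ S)
    (hgood : ∀ ℓ : ℕ, (hℓ : ℓ.Prime) → ℓ ∉ S → haveI : Fact ℓ.Prime := ⟨hℓ⟩;
      padicValRat ℓ (e₁ - e₂) = 0 ∧ padicValRat ℓ (e₁ - e₃) = 0 ∧ padicValRat ℓ (e₂ - e₃) = 0)
    (hqS : q ∉ S) (hq4 : q % 4 = 3)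
    {c : galH1Torsion E 2} (a b : ℚˣ)
    (ha : kummerEquiv ℚ 2 (E.twoTorsionCharH1 h c) = Additive.ofMul (QuotientGroup.mk a))
    (hb : kummerEquiv ℚ 2 (E.twoTorsionCharH1 h.swap₁₂ c) = Additive.ofMul (QuotientGroup.mk b))
    (hsupp : ∀ ℓ : ℕ, (hℓ : ℓ.Prime) → ℓ ∉ S → ℓ ≠ q → haveI : Fact ℓ.Prime := ⟨hℓ⟩;
      parityBit ℓ (a : ℚ) = 0 ∧ parityBit ℓ (b : ℚ) = 0)
    (hloc : ∀ v : HeightOneSpectrum (𝓞 ℚ), natGenerator v ∈ S → c ∈ selmerLocalKer E (v.adicCompletion ℚ) 2) :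
    (signBit (a : ℚ) * signBit (b : ℚ) + signBit (a : ℚ) * signBit ((e₂ - e₁) * (e₂ - e₃)) +
        signBit (b : ℚ) * signBit ((e₁ - e₂) * (e₁ - e₃))) +
      (parityBit q (a : ℚ) * parityBit q (b : ℚ) + parityBit q (b : ℚ) * qrBit q (a : ℚ) + parityBit q (a : ℚ) * qrBit q (b : ℚ) +
        parityBit q (a : ℚ) * qrBit q ((e₂ - e₁) * (e₂ - e₃)) + parityBit q (b : ℚ) * qrBit q ((e₁ - e₂) * (e₁ - e₃))) = 0 := by
  -- integral representatives of the four square classes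
  obtain ⟨A, ca, hA0, hca, hA⟩ := Rat.exists_mul_sq_eq_intCast a.ne_zero
  obtain ⟨B, cb, hB0, hcb, hB⟩ := Rat.exists_mul_sq_eq_intCast b.ne_zero
  obtain ⟨D₁', c₁, hD₁0, hc₁, hD₁⟩ := Rat.exists_mul_sq_eq_intCast h.c_ne_zero
  obtain ⟨D₂', c₂, hD₂0, hc₂, hD₂⟩ := Rat.exists_mul_sq_eq_intCast h.swap₁₂.c_ne_zero
  have hN : 2 * A * B * D₁' * D₂' ≠ 0 :=
    mul_ne_zero (mul_ne_zero (mul_ne_zero (mul_ne_zero two_ne_zero hA0) hB0) hD₁0) hD₂0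
  set f : ℕ → ℤ := fun ℓ => localSign ℓ A B * localSign ℓ A D₂' * localSign ℓ B D₁' with hf
  -- (1) `f ℓ = 1` for every prime `ℓ ≠ q`
  have hf1 : ∀ ℓ : ℕ, ℓ.Prime → ℓ ≠ q → f ℓ = 1 := by
    intro ℓ hℓ hℓq
    haveI : Fact ℓ.Prime := ⟨hℓ⟩
    by_cases hℓS : ℓ ∈ S
    · set v : HeightOneSpectrum (𝓞 ℚ) := (primesEquiv (R := 𝓞 ℚ)).symm ⟨ℓ, hℓ⟩ with hv
      have hgen : natGenerator v = ℓ :=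
        congrArg Subtype.val ((primesEquiv (R := 𝓞 ℚ)).apply_symm_apply ⟨ℓ, hℓ⟩)
      have := localSign_descentForm_eq_one_of_mem_selmerLocalKer E h v (hloc v (hgen ▸ hℓS)) a b ha hb hca hcb hc₁ hc₂
        hA hB hD₁ hD₂
      rwa [hgen] at this
    · have hℓ2 : ℓ ≠ 2 := fun h2 => hℓS (h2 ▸ h2S)
      obtain ⟨hpa, hpb⟩ := hsupp ℓ hℓ hℓS hℓq
      obtain ⟨g12, g13, g23⟩ := hgood ℓ hℓ hℓS
      have heA := even_padicValInt_of_parityBit_eq_zero (ℓ := ℓ) ((bits_eq_of_mul_sq_eq (ℓ := ℓ) a.ne_zero hca hA).1 ▸ hpa)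
      have heB := even_padicValInt_of_parityBit_eq_zero (ℓ := ℓ) ((bits_eq_of_mul_sq_eq (ℓ := ℓ) b.ne_zero hcb hB).1 ▸ hpb)
      have hpD₁ : parityBit ℓ ((e₁ - e₂) * (e₁ - e₃)) = 0 := by
        rw [parityBit, padicValRat.mul (sub_ne_zero.mpr h.ne₁₂) (sub_ne_zero.mpr h.ne₁₃), g12, g13, add_zero, Int.cast_zero]
      have hpD₂ : parityBit ℓ ((e₂ - e₁) * (e₂ - e₃)) = 0 := by
        rw [parityBit, padicValRat.mul (sub_ne_zero.mpr h.ne₁₂.symm) (sub_ne_zero.mpr h.ne₂₃),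
          show e₂ - e₁ = -(e₁ - e₂) by ring, padicValRat.neg, g12, g23, add_zero, Int.cast_zero]
      have heD₁ := even_padicValInt_of_parityBit_eq_zero (ℓ := ℓ) ((bits_eq_of_mul_sq_eq (ℓ := ℓ) h.c_ne_zero hc₁ hD₁).1 ▸ hpD₁)
      have heD₂ := even_padicValInt_of_parityBit_eq_zero (ℓ := ℓ)
        ((bits_eq_of_mul_sq_eq (ℓ := ℓ) h.swap₁₂.c_ne_zero hc₂ hD₂).1 ▸ hpD₂)
      show localSign ℓ A B * localSign ℓ A D₂' * localSign ℓ B D₁' = 1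
      rw [localSign_eq_one_of_even hℓ2 hA0 hB0 heA heB, localSign_eq_one_of_even hℓ2 hA0 hD₂0 heA heD₂,
        localSign_eq_one_of_even hℓ2 hB0 hD₁0 heB heD₁]
      norm_num
  -- (2) reciprocity: the product over `P` collapses to `f q`
  have hrec := prod_localSign_descentForm_eq_one hA0 hB0 hD₁0 hD₂0
  set P := (2 * A * B * D₁' * D₂').natAbs.primeFactors with hP
  have hPprime : ∀ ℓ ∈ P, ℓ.Prime := fun ℓ hℓ => Nat.prime_of_mem_primeFactors hℓ
  have hprod : ∏ ℓ ∈ P, f ℓ = f q := by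
    have e1 : ∏ ℓ ∈ P, f ℓ = ∏ ℓ ∈ P ∪ {q}, f ℓ := by
      refine Finset.prod_subset Finset.subset_union_left fun ℓ hℓU hℓP => ?_
      have hℓprime : ℓ.Prime := by
        rcases Finset.mem_union.mp hℓU with h' | h'
        · exact hPprime ℓ h'
        · rw [Finset.mem_singleton] at h'; rw [h']; exact hq.out
      exact localSign_descentForm_eq_one_of_not_mem hℓprime hℓP hN
    have e2 : ∏ ℓ ∈ P ∪ {q}, f ℓ = ∏ ℓ ∈ ({q} : Finset ℕ), f ℓ := by
      refine (Finset.prod_subset Finset.subset_union_right fun ℓ hℓU hℓ3 => ?_).symm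
      have hℓprime : ℓ.Prime := by
        rcases Finset.mem_union.mp hℓU with h' | h'
        · exact hPprime ℓ h'
        · exact absurd h' hℓ3
      rw [Finset.mem_singleton] at hℓ3
      exact hf1 ℓ hℓprime hℓ3
    rw [e1, e2, Finset.prod_singleton]
  rw [hprod] at hrec
  -- (3) in bits
  obtain ⟨hpa, hra, hsa⟩ := bits_eq_of_mul_sq_eq (ℓ := q) a.ne_zero hca hA
  obtain ⟨hpb, hrb, hsb⟩ := bits_eq_of_mul_sq_eq (ℓ := q) b.ne_zero hcb hB
  obtain ⟨hp1, hr1, hs1⟩ := bits_eq_of_mul_sq_eq (ℓ := q) h.c_ne_zero hc₁ hD₁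
  obtain ⟨hp2, hr2, hs2⟩ := bits_eq_of_mul_sq_eq (ℓ := q) h.swap₁₂.c_ne_zero hc₂ hD₂
  have hparD : parityBit q ((e₁ - e₂) * (e₁ - e₃)) = 0 ∧ parityBit q ((e₂ - e₁) * (e₂ - e₃)) = 0 := by
    obtain ⟨g12, g13, g23⟩ := hgood q hq.out hqS
    refine ⟨?_, ?_⟩
    · rw [parityBit, padicValRat.mul (sub_ne_zero.mpr h.ne₁₂) (sub_ne_zero.mpr h.ne₁₃), g12, g13, add_zero, Int.cast_zero]
    · rw [parityBit, padicValRat.mul (sub_ne_zero.mpr h.ne₁₂.symm) (sub_ne_zero.mpr h.ne₂₃),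
        show e₂ - e₁ = -(e₁ - e₂) by ring, padicValRat.neg, g12, g23, add_zero, Int.cast_zero]
  obtain ⟨hD₁q, hD₂q⟩ := hparD
  have hqn2 : q ≠ 2 := fun h2 => hqS (h2 ▸ h2S)
  have fval : f q = (-1) ^ (parityBit q (A : ℚ) * parityBit q (B : ℚ) + parityBit q (B : ℚ) * qrBit q (A : ℚ) +
        parityBit q (A : ℚ) * qrBit q (B : ℚ) +
        (parityBit q (A : ℚ) * parityBit q (D₂' : ℚ) + parityBit q (D₂' : ℚ) * qrBit q (A : ℚ) + parityBit q (A : ℚ) * qrBit q (D₂' : ℚ)) +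
        (parityBit q (B : ℚ) * parityBit q (D₁' : ℚ) + parityBit q (D₁' : ℚ) * qrBit q (B : ℚ) + parityBit q (B : ℚ) * qrBit q (D₁' : ℚ))).val := by
    simp only [hf, localSign, if_neg hqn2]
    rw [localSignOdd_eq_neg_one_pow_bits hq4 hA0 hB0, localSignOdd_eq_neg_one_pow_bits hq4 hA0 hD₂0,
      localSignOdd_eq_neg_one_pow_bits hq4 hB0 hD₁0, ← neg_one_pow_val_add, ← neg_one_pow_val_add]
  rw [fval, localSignInfty_eq_neg_one_pow_signBit, localSignInfty_eq_neg_one_pow_signBit,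
    localSignInfty_eq_neg_one_pow_signBit, ← neg_one_pow_val_add, ← neg_one_pow_val_add, ← neg_one_pow_val_add,
    neg_one_pow_val_eq_one_iff] at hrec
  rw [hsa, hsb, hs1, hs2, hpa, hpb, hra, hrb, hr1, hr2]
  rw [← hp1, ← hp2, hD₁q, hD₂q] at hrec
  simp only [mul_zero, zero_mul, add_zero, zero_add] at hrec
  linear_combination hrec

end Summit.BirchSwinnertonDyer.BirchSwinnertonDyer.Theorems.GenusKolyvaginAtTwo.TorsionCellSEL

end
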